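import Literature.Barriers.PneNP.Locality
import Literature.Computability.Complexity.ACFourierTails
import Literature.Computability.Complexity.ACRealize
import Literature.Computability.Complexity.CircuitClassesProofs
import HarnessLib

/-!
# The `AC⁰` lower bound for parity localizes: proof of `Locality_parityLocalizes` (CHOPRS Prop. 50, E3^𝒪)

Discharges (D-0014) the named fact `Literature.Barriers.PneNP.Locality_parityLocalizes` of
`Literature/Barriers/PneNP/Locality.lean` (Chen–Hirahara–Oliveira–Pich–Rajgopal–Santhanam,
*Beyond natural proofs: hardness magnification and locality*, ITCS 2020 / arXiv:1911.08297,
Prop. 50, item (E3^𝒪), p. 27): **for every oracle `𝒪`, depth `d`, polynomial size bound `p`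
and wire budget `w` with `w(n) (log₂ n)^j ≤ n` eventually for every `j`, no family of
depth-`d`, size-`p(n)` circuits over `∧, ∨, ¬` and `𝒪`-gates whose oracle gates have total
fan-in `≤ w(n)` decides `PARITY`** — `Locality_parityLocalizes_holds`.

The printed proof (ibid.) is a pointer: "simulating oracle circuits via interactive compression
games [Oliveira–Santhanam, CCC 2015] ... the desired lower bound for oracle circuits then follows
immediately from the main result of [Chattopadhyay–Santhanam, FOCS 2012]" (random restrictions for
circuits with oracle gates). The proof given here is self-contained on top of the tree and takes
a shorter route to the same statement, through A. Tal's Fourier-tail bound for `AC⁰`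
(`ACForm.tailWeight_le_tailBound`, Tal 2017 Thm. 3.6, proved in
`Literature/Computability/Complexity/ACFourierTails.lean` from Håstad's multi-switching lemma):

1. **Guessing the oracle wires** (`ParityLocalizes.guessFn`). For a circuit `E` (any gates) of
   `acDepth ≤ d` and a guess `β` of the bits carried by the input wires of its *relevant* oracle
   gates (the gates outside `acBasis` of depth `≤ d`; `ParityLocalizes.relGates`), let `E_β` be
   `E` with every oracle gate replaced by the constant it outputs on the guessed inputs
   (`GateList.deorc`), and `F_β(x) = [every guessed wire of E_β carries its guessed bit on x] ∧
   E_β(x)`. By the gate equations (`GateList.getD_vals_eq_op`) and induction along the program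
   (`GateList.getD_vals_map_deorc_eq`), `F_β(x) = 1` iff `β` is the true wire pattern of `x` and
   `E(x) = 1` (`guessFn_eq_true_iff`); hence `[E] = ∑_β [F_β]` pointwise
   (`sum_guessFn_indicator`), the number of guesses is `2^P` with `P ≤ W :=` total fan-in of the
   oracle gates (`card_OPos_le`), and each `F_β` is an `AC⁰` function of depth `d + 1` and size
   `≤ (W+1)(|E|+1)+1` (`acReal_guessFn`, through the `ACReal` toolkit of `ACRealize.lean`).
2. **Fourier** (`exists_guess_coeff_ge`). In `{±1}` notation `∑_β sgn F_β = (2^P - 1) + sgn E`,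
   so at the top character the coefficients of the `F_β` sum to that of `E`; for `E` computing
   parity the latter is `1` (`sgn ∘ parity = χ_{[n]}`, `sgn_parityFn`), so some `β` has
   `\hat{F_β}([n]) ≥ 2^{-P}` and top Fourier weight `≥ 4^{-P}`.
3. **Tal's bound** (`main_ineq`): that weight is `≤ 8^{d+2} 2^{-n/(B^{d+2} ℓ^d)}` with
   `ℓ = ⌊log₂(2 s₁ + 1)⌋`, `s₁ = (W+1)(s+1)+1`, `B = 16896`; hence
   `n ≤ B^{d+2} ℓ^d (3(d+2) + 2W)`.
4. **Asymptotics** (`endgame`, `Locality_parityLocalizes_holds`): with `s = p(n)`, `W = w(n) ≤ n`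
   one has `ℓ = O(log n)`, and `w(n)(log₂ n)^{d+1} ≤ n` makes the right-hand side `< n` for
   large `n`.

Everything is proved; the only new definitions are the bookkeeping ones of step 1. As a
corollary (`w = 0`) the file records the class statement `PARITY ∉ AC0` (`PARITY_not_mem_AC0`).

## References

* L. Chen, S. Hirahara, I. C. Oliveira, J. Pich, N. Rajgopal, R. Santhanam, *Beyond natural
  proofs: hardness magnification and locality*, ITCS 2020 (LIPIcs 151:70) / J. ACM 69 (2022),
  arXiv:1911.08297: Prop. 50 (E3^𝒪) and its proof, p. 27; §1.3 [arXiv191108297].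
* A. Tal, *Tight bounds on the Fourier spectrum of AC⁰*, CCC 2017 / ECCC TR14-174, Thm. 3.6
  [Tal2017].
* R. O'Donnell, *Analysis of Boolean Functions*, CUP 2014, §1.2–1.4 [ODonnell2014].
-/

noncomputable section

open Classical Finset Filter

namespace Literature.Barriers.PneNP

namespace GateList

variable {ι : Type*}

/-! ### Gate and depth equations of a straight-line program -/

/-- Splitting a program at position `j`. [folklore] -/
theorem eq_take_append_getElem_cons (gs : List (Literature.Computability.Complexity.Gate ι)) {j : ℕ} (hj : j < gs.length) :
    gs = gs.take j ++ gs[j] :: gs.drop (j + 1) := by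
  rw [← List.drop_eq_getElem_cons hj, List.take_append_drop]

/-- **Gate equation** (full-list form): in a well-formed program, the value of gate `j` is its
truth table applied to the values, in the whole value list, of its argument wires
(Arora–Barak 2009, Rem. 6.4). [folklore] -/
theorem getD_vals_eq_op (gs : List (Literature.Computability.Complexity.Gate ι)) (hwf : Literature.Computability.Complexity.GateList.WF gs) {j : ℕ} (hj : j < gs.length)
    (x : ι → Bool) :
    (Literature.Computability.Complexity.GateList.vals gs x).getD j false = (gs[j]).op (fun a => Literature.Computability.Complexity.GateList.wireOf x (Literature.Computability.Complexity.GateList.vals gs x) ((gs[j]).args a)) := by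
  have hsplit := eq_take_append_getElem_cons gs hj
  have hlen : (gs.take j).length = j := List.length_take_of_le hj.le
  have hOK : Literature.Computability.Complexity.GateList.GateOK j (gs[j]) := hwf j _ (List.getElem?_eq_getElem hj)
  have hv : Literature.Computability.Complexity.GateList.vals gs x = Literature.Computability.Complexity.GateList.vals (gs.take j ++ gs[j] :: gs.drop (j + 1)) x :=
    congrArg (Literature.Computability.Complexity.GateList.vals · x) hsplit
  have h1 : (Literature.Computability.Complexity.GateList.vals gs x).getD j false =
      (gs[j]).op (fun a => Literature.Computability.Complexity.GateList.wireOf x (Literature.Computability.Complexity.GateList.vals (gs.take j) x) ((gs[j]).args a)) := by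
    have := Literature.Computability.Complexity.GateList.getD_vals_append_cons (gs.take j) (gs[j]) (gs.drop (j + 1)) x
    rwa [hlen, ← hv] at this
  rw [h1]
  congr 1
  funext a
  rw [hv, Literature.Computability.Complexity.GateList.wireOf_vals_append]
  intro m hm
  rw [hlen]
  exact hOK a m hm

/-- **Depth equation** (full-list form): in a well-formed program, the weighted depth of gate `j`
is its weight plus the maximal depth, in the whole depth list, of its argument wires
(Vollmer 1999, §1.2). [folklore] -/
theorem getD_wdepths_eq (w : Literature.Computability.Complexity.GateFn → ℕ) (gs : List (Literature.Computability.Complexity.Gate ι)) (hwf : Literature.Computability.Complexity.GateList.WF gs) {j : ℕ}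
    (hj : j < gs.length) :
    (Literature.Computability.Complexity.GateList.wdepths w gs).getD j 0 =
      w (gs[j]).fn + univ.sup (fun a => Literature.Computability.Complexity.GateList.wireDepthOf (Literature.Computability.Complexity.GateList.wdepths w gs) ((gs[j]).args a)) := by
  have hsplit := eq_take_append_getElem_cons gs hj
  have hlen : (gs.take j).length = j := List.length_take_of_le hj.le
  have hOK : Literature.Computability.Complexity.GateList.GateOK j (gs[j]) := hwf j _ (List.getElem?_eq_getElem hj)
  have hd : Literature.Computability.Complexity.GateList.wdepths w gs = Literature.Computability.Complexity.GateList.wdepths w ((gs.take j ++ [gs[j]]) ++ gs.drop (j + 1)) := by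
    rw [List.append_assoc]; exact congrArg _ hsplit
  obtain ⟨ws, hws⟩ := Literature.Computability.Complexity.GateList.wdepths_append_take w (gs.take j ++ [gs[j]]) (gs.drop (j + 1))
  have h2 := Literature.Computability.Complexity.GateList.getD_wdepths_append_singleton w (gs.take j) (gs[j])
  rw [hlen] at h2
  have h1 : (Literature.Computability.Complexity.GateList.wdepths w gs).getD j 0 = (Literature.Computability.Complexity.GateList.wdepths w (gs.take j ++ [gs[j]])).getD j 0 := by
    rw [hd, hws, List.getD_eq_getElem?_getD, List.getElem?_append_left
      (by rw [Literature.Computability.Complexity.GateList.length_wdepths, List.length_append, List.length_singleton, hlen]; exact j.lt_succ_self),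
      ← List.getD_eq_getElem?_getD]
  rw [h1, h2]
  congr 1
  refine Finset.sup_congr rfl fun a _ => ?_
  have hd' : Literature.Computability.Complexity.GateList.wdepths w gs = Literature.Computability.Complexity.GateList.wdepths w (gs.take j ++ (gs[j] :: gs.drop (j + 1))) := congrArg _ hsplit
  rw [hd', Literature.Computability.Complexity.GateList.wireDepthOf_wdepths_append]
  intro m hm
  rw [hlen]
  exact hOK a m hm

/-- Depth is monotone along the wires of a well-formed program: an argument wire of gate `j` is
no deeper than gate `j`. [folklore] -/
theorem wireDepthOf_args_le (w : Literature.Computability.Complexity.GateFn → ℕ) (gs : List (Literature.Computability.Complexity.Gate ι)) (hwf : Literature.Computability.Complexity.GateList.WF gs) {j : ℕ}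
    (hj : j < gs.length) (a : Fin (gs[j]).arity) :
    Literature.Computability.Complexity.GateList.wireDepthOf (Literature.Computability.Complexity.GateList.wdepths w gs) ((gs[j]).args a) ≤ (Literature.Computability.Complexity.GateList.wdepths w gs).getD j 0 := by
  rw [getD_wdepths_eq w gs hwf hj]
  exact le_add_left (Finset.le_sup (f := fun a => Literature.Computability.Complexity.GateList.wireDepthOf (Literature.Computability.Complexity.GateList.wdepths w gs) ((gs[j]).args a))
    (Finset.mem_univ a))

/-! ### Replacing the non-`AC` gates of a program by constants -/

/-- Replace a gate outside `acBasis` (an "oracle gate") by the constant gate `c g`; gates of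
`acBasis` are kept. [folklore] -/
def deorc (c : Literature.Computability.Complexity.Gate ι → Bool) (g : Literature.Computability.Complexity.Gate ι) : Literature.Computability.Complexity.Gate ι :=
  if g.fn ∈ Literature.Computability.Complexity.acBasis then g else Literature.Computability.Complexity.GateList.constGate ι (c g)

/-- `deorc` on an `AC` gate. [folklore] -/
theorem deorc_of_mem (c : Literature.Computability.Complexity.Gate ι → Bool) {g : Literature.Computability.Complexity.Gate ι} (h : g.fn ∈ Literature.Computability.Complexity.acBasis) : deorc c g = g := by
  simp [deorc, h]

/-- `deorc` on an oracle gate. [folklore] -/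
theorem deorc_of_not_mem (c : Literature.Computability.Complexity.Gate ι → Bool) {g : Literature.Computability.Complexity.Gate ι} (h : g.fn ∉ Literature.Computability.Complexity.acBasis) :
    deorc c g = Literature.Computability.Complexity.GateList.constGate ι (c g) := by
  simp [deorc, h]

/-- After `deorc` every gate is an `AC` gate. [folklore] -/
theorem deorc_fn_mem (c : Literature.Computability.Complexity.Gate ι → Bool) (g : Literature.Computability.Complexity.Gate ι) : (deorc c g).fn ∈ Literature.Computability.Complexity.acBasis := by
  by_cases h : g.fn ∈ Literature.Computability.Complexity.acBasis
  · rw [deorc_of_mem c h]; exact h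
  · rw [deorc_of_not_mem c h, Literature.Computability.Complexity.GateList.constGate_fn]; exact Literature.Computability.Complexity.const_mem_acBasis _

/-- `deorc` keeps gates valid at their position. [folklore] -/
theorem gateOK_deorc (c : Literature.Computability.Complexity.Gate ι → Bool) {n : ℕ} {g : Literature.Computability.Complexity.Gate ι} (h : Literature.Computability.Complexity.GateList.GateOK n g) :
    Literature.Computability.Complexity.GateList.GateOK n (deorc c g) := by
  by_cases hg : g.fn ∈ Literature.Computability.Complexity.acBasis
  · rw [deorc_of_mem c hg]; exact h
  · rw [deorc_of_not_mem c hg]; exact Literature.Computability.Complexity.GateList.gateOK_constGate n _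

/-- `deorc` keeps programs well formed. [folklore] -/
theorem _root_.Literature.Computability.Complexity.GateList.WF.map_deorc {gs : List (Literature.Computability.Complexity.Gate ι)} (hwf : Literature.Computability.Complexity.GateList.WF gs) (c : Literature.Computability.Complexity.Gate ι → Bool) :
    Literature.Computability.Complexity.GateList.WF (gs.map (deorc c)) := by
  intro j g hj
  rw [List.getElem?_map] at hj
  obtain ⟨g₀, hg₀, rfl⟩ := Option.map_eq_some_iff.1 hj
  exact gateOK_deorc c (hwf j g₀ hg₀)

/-- The weight of an oracle gate is `1` (it is not the negation gate). [folklore] -/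
theorem acWeight_of_not_mem {f : Literature.Computability.Complexity.GateFn} (h : f ∉ Literature.Computability.Complexity.acBasis) : Literature.Computability.Complexity.acWeight f = 1 := by
  unfold Literature.Computability.Complexity.acWeight
  split
  · next hf => exact absurd (hf ▸ Literature.Computability.Complexity.mem_acBasis_not) h
  · rfl

/-- **`deorc` does not increase depths.** [folklore] -/
theorem getD_wdepths_map_deorc_le (gs : List (Literature.Computability.Complexity.Gate ι)) (hwf : Literature.Computability.Complexity.GateList.WF gs) (c : Literature.Computability.Complexity.Gate ι → Bool) :
    ∀ j, (Literature.Computability.Complexity.GateList.wdepths Literature.Computability.Complexity.acWeight (gs.map (deorc c))).getD j 0 ≤ (Literature.Computability.Complexity.GateList.wdepths Literature.Computability.Complexity.acWeight gs).getD j 0 := by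
  intro j
  induction j using Nat.strong_induction_on with
  | _ j ih =>
    by_cases hj : j < gs.length
    · have hj' : j < (gs.map (deorc c)).length := by simpa using hj
      rw [getD_wdepths_eq Literature.Computability.Complexity.acWeight _ (hwf.map_deorc c) hj', getD_wdepths_eq Literature.Computability.Complexity.acWeight gs hwf hj]
      have hget : (gs.map (deorc c))[j] = deorc c (gs[j]) := List.getElem_map _
      by_cases hg : (gs[j]).fn ∈ Literature.Computability.Complexity.acBasis
      · have hget' : (gs.map (deorc c))[j] = gs[j] := by rw [hget, deorc_of_mem c hg]
        -- rewrite the gate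
        have key : ∀ (g : Literature.Computability.Complexity.Gate ι), g = gs[j] →
            Literature.Computability.Complexity.acWeight g.fn + univ.sup (fun a => Literature.Computability.Complexity.GateList.wireDepthOf (Literature.Computability.Complexity.GateList.wdepths Literature.Computability.Complexity.acWeight (gs.map (deorc c))) (g.args a)) ≤
              Literature.Computability.Complexity.acWeight (gs[j]).fn + univ.sup (fun a => Literature.Computability.Complexity.GateList.wireDepthOf (Literature.Computability.Complexity.GateList.wdepths Literature.Computability.Complexity.acWeight gs) ((gs[j]).args a)) := by
          rintro g rfl
          refine Nat.add_le_add_left (Finset.sup_mono_fun fun a _ => ?_) _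
          rcases hu : (gs[j]).args a with i | m
          · simp
          · simp only [Literature.Computability.Complexity.GateList.wireDepthOf_inr]
            exact ih m (hwf j _ (List.getElem?_eq_getElem hj) a m hu)
        have := key _ hget'
        convert this using 2
      · have hget' : (gs.map (deorc c))[j] = Literature.Computability.Complexity.GateList.constGate ι (c (gs[j])) := by
          rw [hget, deorc_of_not_mem c hg]
        have lhs : Literature.Computability.Complexity.acWeight ((gs.map (deorc c))[j]).fn +
            univ.sup (fun a => Literature.Computability.Complexity.GateList.wireDepthOf (Literature.Computability.Complexity.GateList.wdepths Literature.Computability.Complexity.acWeight (gs.map (deorc c))) (((gs.map (deorc c))[j]).args a)) = 1 := by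
          have key : ∀ (g : Literature.Computability.Complexity.Gate ι), g = Literature.Computability.Complexity.GateList.constGate ι (c (gs[j])) →
              Literature.Computability.Complexity.acWeight g.fn + univ.sup (fun a => Literature.Computability.Complexity.GateList.wireDepthOf (Literature.Computability.Complexity.GateList.wdepths Literature.Computability.Complexity.acWeight (gs.map (deorc c))) (g.args a)) = 1 := by
            rintro g rfl
            rw [Literature.Computability.Complexity.GateList.constGate_fn, Literature.Computability.Complexity.acWeight_const]
            simp [Literature.Computability.Complexity.GateList.constGate]
          exact key _ hget'
        rw [lhs, acWeight_of_not_mem hg]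
        exact Nat.le_add_right 1 _
    · push Not at hj
      rw [List.getD_eq_default _ _ (by simpa using hj)]
      exact Nat.zero_le _

/-- **Agreement of the values under guards.** If, on input `x`, every oracle gate of depth `≤ d`
outputs the constant replacing it — the guard being checked either on the original values or on
the values of the modified program — then the two programs agree on every gate of depth `≤ d`. [folklore] -/
theorem getD_vals_map_deorc_eq (gs : List (Literature.Computability.Complexity.Gate ι)) (hwf : Literature.Computability.Complexity.GateList.WF gs) (c : Literature.Computability.Complexity.Gate ι → Bool) (d : ℕ)
    (x : ι → Bool)
    (hguard : ∀ (j : ℕ) (hj : j < gs.length), (gs[j]).fn ∉ Literature.Computability.Complexity.acBasis →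
      (Literature.Computability.Complexity.GateList.wdepths Literature.Computability.Complexity.acWeight gs).getD j 0 ≤ d →
        (gs[j]).op (fun a => Literature.Computability.Complexity.GateList.wireOf x (Literature.Computability.Complexity.GateList.vals gs x) ((gs[j]).args a)) = c (gs[j]) ∨
        (gs[j]).op (fun a => Literature.Computability.Complexity.GateList.wireOf x (Literature.Computability.Complexity.GateList.vals (gs.map (deorc c)) x) ((gs[j]).args a)) = c (gs[j])) :
    ∀ j < gs.length, (Literature.Computability.Complexity.GateList.wdepths Literature.Computability.Complexity.acWeight gs).getD j 0 ≤ d →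
      (Literature.Computability.Complexity.GateList.vals gs x).getD j false = (Literature.Computability.Complexity.GateList.vals (gs.map (deorc c)) x).getD j false := by
  intro j
  induction j using Nat.strong_induction_on with
  | _ j ih =>
    intro hj hdj
    have hj' : j < (gs.map (deorc c)).length := by simpa using hj
    have hget : (gs.map (deorc c))[j] = deorc c (gs[j]) := List.getElem_map _
    have hOK : Literature.Computability.Complexity.GateList.GateOK j (gs[j]) := hwf j _ (List.getElem?_eq_getElem hj)
    -- the argument wires agree
    have hargs : ∀ a : Fin (gs[j]).arity, Literature.Computability.Complexity.GateList.wireOf x (Literature.Computability.Complexity.GateList.vals gs x) ((gs[j]).args a) =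
        Literature.Computability.Complexity.GateList.wireOf x (Literature.Computability.Complexity.GateList.vals (gs.map (deorc c)) x) ((gs[j]).args a) := by
      intro a
      rcases hu : (gs[j]).args a with i | m
      · rfl
      · simp only [Literature.Computability.Complexity.GateList.wireOf_inr]
        have hm : m < j := hOK a m hu
        refine ih m hm (hm.trans hj) ?_
        have := wireDepthOf_args_le Literature.Computability.Complexity.acWeight gs hwf hj a
        rw [hu, Literature.Computability.Complexity.GateList.wireDepthOf_inr] at this
        exact this.trans hdj
    rw [getD_vals_eq_op gs hwf hj x, getD_vals_eq_op _ (hwf.map_deorc c) hj' x]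
    by_cases hg : (gs[j]).fn ∈ Literature.Computability.Complexity.acBasis
    · have hget' : (gs.map (deorc c))[j] = gs[j] := by rw [hget, deorc_of_mem c hg]
      have key : ∀ g : Literature.Computability.Complexity.Gate ι, g = gs[j] →
          g.op (fun a => Literature.Computability.Complexity.GateList.wireOf x (Literature.Computability.Complexity.GateList.vals (gs.map (deorc c)) x) (g.args a)) =
            (gs[j]).op (fun a => Literature.Computability.Complexity.GateList.wireOf x (Literature.Computability.Complexity.GateList.vals (gs.map (deorc c)) x) ((gs[j]).args a)) := by
        rintro g rfl; rfl
      rw [key _ hget']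
      congr 1
      funext a
      exact hargs a
    · have hget' : (gs.map (deorc c))[j] = Literature.Computability.Complexity.GateList.constGate ι (c (gs[j])) := by
        rw [hget, deorc_of_not_mem c hg]
      have key : ∀ g : Literature.Computability.Complexity.Gate ι, g = Literature.Computability.Complexity.GateList.constGate ι (c (gs[j])) →
          g.op (fun a => Literature.Computability.Complexity.GateList.wireOf x (Literature.Computability.Complexity.GateList.vals (gs.map (deorc c)) x) (g.args a)) = c (gs[j]) := by
        rintro g rfl; rfl
      rw [key _ hget']
      rcases hguard j hj hg hdj with h | h
      · exact h
      · rw [← h]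
        congr 1
        funext a
        exact hargs a

end GateList

end Literature.Barriers.PneNP

open Literature.Computability.Complexity Literature.Barriers.PneNP Literature.Computability.Complexity.GateList Literature.Barriers.PneNP.GateList Literature.Probability.RandomGraphs.LowDegree Literature.Computability.Complexity.LowDegree

namespace Literature.Barriers.PneNP

namespace ParityLocalizes

variable {ι : Type*}

/-! ### Guessing the oracle wires: the `2^W` AC⁰ subfunctions of an oracle circuit -/

/-- The `acWeight`-depth of a gate of the circuit `E` (position independent: weight plus the
maximal depth of its argument wires). [folklore] -/
def gdepth (E : Circuit ι) (g : Gate ι) : ℕ :=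
  acWeight g.fn + univ.sup (fun a => wireDepthOf (wdepths acWeight E.gates) (g.args a))

/-- The *relevant oracle gates* of `E` at depth budget `d`: the gates outside `acBasis` of depth
at most `d` (all oracle gates feeding the output are among them when `E.acDepth ≤ d`). [folklore] -/
def relGates (E : Circuit ι) (d : ℕ) : Finset (Gate ι) :=
  E.gates.toFinset.filter fun g => g.fn ∉ acBasis ∧ gdepth E g ≤ d

/-- The *oracle positions*: an input position of a relevant oracle gate. A guess assigns a
Boolean to each of them. [folklore] -/
abbrev OPos (E : Circuit ι) (d : ℕ) : Type _ := Σ g : relGates E d, Fin g.1.arity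

/-- The constants replacing the oracle gates under the guess `β`: a relevant oracle gate answers
its own truth table on the guessed inputs; the other oracle gates are irrelevant (`false`). [folklore] -/
def guessConst (E : Circuit ι) (d : ℕ) (β : OPos E d → Bool) (g : Gate ι) : Bool :=
  if h : g ∈ relGates E d then g.op (fun a => β ⟨⟨g, h⟩, a⟩) else false

/-- The oracle-free program of the guess `β`. [folklore] -/
abbrev guessGates (E : Circuit ι) (d : ℕ) (β : OPos E d → Bool) : List (Gate ι) :=
  E.gates.map (deorc (guessConst E d β))

/-- The literals of the guess `β`: `none` is the output wire of the oracle-free program,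
`some ⟨g, a⟩` checks that the `a`-th input wire of the relevant oracle gate `g` carries the
guessed bit. [folklore] -/
def guessLit (E : Circuit ι) (d : ℕ) (β : OPos E d → Bool) : Option (OPos E d) → (ι → Bool) → Bool
  | none, x => wireOf x (vals (guessGates E d β) x) E.output
  | some p, x => if β p then wireOf x (vals (guessGates E d β) x) (p.1.1.args p.2)
      else !wireOf x (vals (guessGates E d β) x) (p.1.1.args p.2)

/-- `guessLit (some p)` tests that the wire carries the guessed bit. [folklore] -/
theorem guessLit_some_eq_true_iff (E : Circuit ι) (d : ℕ) (β : OPos E d → Bool) (p : OPos E d)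
    (x : ι → Bool) :
    guessLit E d β (some p) x = true ↔ wireOf x (vals (guessGates E d β) x) (p.1.1.args p.2) = β p := by
  simp only [guessLit]
  cases β p <;> simp

/-- **The subfunction of the guess `β`**: all guards hold and the oracle-free program accepts. [folklore] -/
def guessFn (E : Circuit ι) (d : ℕ) (β : OPos E d → Bool) (x : ι → Bool) : Bool :=
  decide (∀ k : Option (OPos E d), guessLit E d β k x = true)

/-- The true values, on input `x`, of the oracle positions. [folklore] -/
def trueGuess (E : Circuit ι) (d : ℕ) (x : ι → Bool) : OPos E d → Bool :=
  fun p => wireOf x (vals E.gates x) (p.1.1.args p.2)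

/-- A relevant oracle gate is a gate of `E`, outside `acBasis`, of depth `≤ d`. [folklore] -/
theorem mem_relGates_iff {E : Circuit ι} {d : ℕ} {g : Gate ι} :
    g ∈ relGates E d ↔ g ∈ E.gates ∧ g.fn ∉ acBasis ∧ gdepth E g ≤ d := by
  simp [relGates, List.mem_toFinset]

/-- The gate at position `j` has depth `gdepth`. [folklore] -/
theorem gdepth_getElem (E : Circuit ι) {j : ℕ} (hj : j < E.gates.length) :
    gdepth E (E.gates[j]) = (wdepths acWeight E.gates).getD j 0 := by
  rw [gdepth, getD_wdepths_eq acWeight E.gates (wf_gates E) hj]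

/-- The argument wires of a gate of `E` are valid wires. [folklore] -/
theorem outOK_args {E : Circuit ι} {g : Gate ι} (hg : g ∈ E.gates) (a : Fin g.arity) :
    OutOK E.gates.length (g.args a) := by
  obtain ⟨j, hj, rfl⟩ := List.mem_iff_getElem.1 hg
  intro m hm
  exact ((wf_gates E) j _ (List.getElem?_eq_getElem hj) a m hm).trans hj

/-- The argument wires of a gate are no deeper than the gate. [folklore] -/
theorem wireDepthOf_args_le_gdepth (E : Circuit ι) (g : Gate ι) (a : Fin g.arity) :
    wireDepthOf (wdepths acWeight E.gates) (g.args a) ≤ gdepth E g :=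
  le_add_left (Finset.le_sup (f := fun a => wireDepthOf (wdepths acWeight E.gates) (g.args a))
    (Finset.mem_univ a))

/-- **Agreement**: if the guards of `β` hold on `x` — on the original values or on the values of
the oracle-free program — then every valid wire of depth `≤ d` carries the same bit in both
programs. [folklore] -/
theorem wireOf_guessGates_eq (E : Circuit ι) (d : ℕ) (β : OPos E d → Bool) (x : ι → Bool)
    (hguard : (∀ p : OPos E d, wireOf x (vals E.gates x) (p.1.1.args p.2) = β p) ∨
      (∀ p : OPos E d, wireOf x (vals (guessGates E d β) x) (p.1.1.args p.2) = β p))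
    {u : ι ⊕ ℕ} (hu : OutOK E.gates.length u) (hdu : wireDepthOf (wdepths acWeight E.gates) u ≤ d) :
    wireOf x (vals E.gates x) u = wireOf x (vals (guessGates E d β) x) u := by
  have key := getD_vals_map_deorc_eq E.gates (wf_gates E) (guessConst E d β) d x ?_
  · cases u with
    | inl i => rfl
    | inr m =>
      simp only [wireOf_inr]
      exact key m (hu m rfl) (by simpa using hdu)
  · intro j hj hfn hdj
    have hmem : E.gates[j] ∈ relGates E d :=
      mem_relGates_iff.2 ⟨List.getElem_mem hj, hfn, by rwa [gdepth_getElem E hj]⟩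
    have hc : guessConst E d β (E.gates[j]) = (E.gates[j]).op (fun a => β ⟨⟨E.gates[j], hmem⟩, a⟩) := by
      simp [guessConst, hmem]
    rw [hc]
    rcases hguard with h | h
    · left
      congr 1
      funext a
      exact h ⟨⟨E.gates[j], hmem⟩, a⟩
    · right
      congr 1
      funext a
      exact h ⟨⟨E.gates[j], hmem⟩, a⟩

/-- **Characterisation of the subfunctions**: `guessFn β` accepts `x` iff `β` is the true value
of the oracle positions on `x` and `E` accepts `x` (for `E.acDepth ≤ d`). [folklore] -/
theorem guessFn_eq_true_iff (E : Circuit ι) {d : ℕ} (hd : E.acDepth ≤ d) (β : OPos E d → Bool)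
    (x : ι → Bool) : guessFn E d β x = true ↔ β = trueGuess E d x ∧ E.eval x = true := by
  have hout : wireDepthOf (wdepths acWeight E.gates) E.output ≤ d := by
    rw [← circuit_depthWith]; exact hd
  have hpos : ∀ p : OPos E d, OutOK E.gates.length (p.1.1.args p.2) ∧
      wireDepthOf (wdepths acWeight E.gates) (p.1.1.args p.2) ≤ d := by
    rintro ⟨⟨g, hg⟩, a⟩
    obtain ⟨hmem, -, hdep⟩ := mem_relGates_iff.1 hg
    exact ⟨outOK_args hmem a, (wireDepthOf_args_le_gdepth E g a).trans hdep⟩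
  simp only [guessFn, decide_eq_true_eq, Option.forall, guessLit_some_eq_true_iff]
  constructor
  · rintro ⟨hnone, hsome⟩
    have hag := fun (u : ι ⊕ ℕ) => wireOf_guessGates_eq E d β x (Or.inr hsome) (u := u)
    refine ⟨funext fun p => ?_, ?_⟩
    · rw [← hsome p, trueGuess, hag _ (hpos p).1 (hpos p).2]
    · rw [circuit_eval, hag _ E.wf_output hout]
      exact hnone
  · rintro ⟨rfl, hev⟩
    have hag := fun (u : ι ⊕ ℕ) => wireOf_guessGates_eq E d (trueGuess E d x) x
      (Or.inl fun p => rfl) (u := u)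
    refine ⟨?_, fun p => ?_⟩
    · show wireOf x (vals (guessGates E d (trueGuess E d x)) x) E.output = true
      rw [← hag _ E.wf_output hout, ← circuit_eval]
      exact hev
    · rw [← hag _ (hpos p).1 (hpos p).2]
      rfl

/-- **Decomposition**: on every input exactly the true guess may accept, and it accepts iff `E`
does: `[E(x)] = ∑_β [guessFn β (x)]`. [folklore] -/
theorem sum_guessFn_indicator (E : Circuit ι) {d : ℕ} (hd : E.acDepth ≤ d) (x : ι → Bool) :
    ∑ β : OPos E d → Bool, (if guessFn E d β x then (1 : ℝ) else 0) = if E.eval x then 1 else 0 := by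
  rw [Finset.sum_eq_single (trueGuess E d x)]
  · by_cases hev : E.eval x = true
    · rw [if_pos ((guessFn_eq_true_iff E hd _ x).2 ⟨rfl, hev⟩), if_pos hev]
    · rw [if_neg (fun h => hev ((guessFn_eq_true_iff E hd _ x).1 h).2), if_neg hev]
  · intro β _ hβ
    rw [if_neg (fun h => hβ ((guessFn_eq_true_iff E hd _ x).1 h).1)]
  · intro h; exact absurd (Finset.mem_univ _) h

/-! ### The subfunctions are small constant-depth AC⁰ functions -/

/-- A valid wire of depth `≤ d` of the oracle-free program is realized at depth `d` with
`|E|` gates. [folklore] -/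
theorem acReal_wire (E : Circuit ι) (d : ℕ) (β : OPos E d → Bool) {u : ι ⊕ ℕ}
    (hu : OutOK E.gates.length u) (hdu : wireDepthOf (wdepths acWeight E.gates) u ≤ d) :
    ACReal (fun x => wireOf x (vals (guessGates E d β) x) u) d E.gates.length := by
  refine ⟨guessGates E d β, u, (wf_gates E).map_deorc _, fun g hg => ?_, by simpa using hu,
    by simp, ?_, fun x => rfl⟩
  · obtain ⟨g₀, -, rfl⟩ := List.mem_map.1 hg
    exact deorc_fn_mem _ g₀
  · cases u with
    | inl i => exact Nat.zero_le _
    | inr m =>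
      simp only [wireDepthOf_inr] at hdu ⊢
      exact (getD_wdepths_map_deorc_le E.gates (wf_gates E) _ m).trans hdu

/-- Each literal of a guess is realized at depth `d` with `|E| + 1` gates. [folklore] -/
theorem acReal_guessLit (E : Circuit ι) {d : ℕ} (hd : E.acDepth ≤ d) (β : OPos E d → Bool)
    (k : Option (OPos E d)) : ACReal (guessLit E d β k) d (E.gates.length + 1) := by
  rcases k with _ | ⟨⟨g, hg⟩, a⟩
  · refine (acReal_wire E d β E.wf_output ?_).mono le_rfl (Nat.le_succ _)
    rw [← circuit_depthWith]; exact hd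
  · obtain ⟨hmem, -, hdep⟩ := mem_relGates_iff.1 hg
    have hw := acReal_wire E d β (outOK_args hmem a) ((wireDepthOf_args_le_gdepth E g a).trans hdep)
    by_cases hb : β ⟨⟨g, hg⟩, a⟩ = true
    · refine (hw.mono le_rfl (Nat.le_succ _)).congr fun x => ?_
      simp [guessLit, hb]
    · refine hw.neg.congr fun x => ?_
      simp [guessLit, hb]

/-- **The subfunction of a guess is an AC⁰ function of depth `d + 1` and size
`(#positions + 1)(|E| + 1) + 1`.** [folklore] -/
theorem acReal_guessFn (E : Circuit ι) {d : ℕ} (hd : E.acDepth ≤ d) (β : OPos E d → Bool) :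
    ACReal (guessFn E d β) (d + 1) ((Fintype.card (OPos E d) + 1) * (E.gates.length + 1) + 1) := by
  have := acReal_forall_fintype (acReal_guessLit E hd β)
  rw [Fintype.card_option] at this
  exact this.congr fun x => rfl

/-! ### Counting the positions -/

/-- The number of oracle positions is at most the total fan-in of the gates outside `acBasis`. [folklore] -/
theorem card_OPos_le (E : Circuit ι) (d : ℕ) :
    Fintype.card (OPos E d) ≤ (E.gates.map fun g => if g.fn ∈ acBasis then 0 else g.arity).sum := by
  set φ : Gate ι → ℕ := fun g => if g.fn ∈ acBasis then 0 else g.arity with hφ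
  rw [Fintype.card_sigma]
  simp only [Fintype.card_fin]
  rw [Finset.sum_coe_sort (relGates E d) (fun g => g.arity)]
  calc ∑ g ∈ relGates E d, g.arity = ∑ g ∈ relGates E d, φ g := by
        refine Finset.sum_congr rfl fun g hg => ?_
        rw [hφ]; simp [(mem_relGates_iff.1 hg).2.1]
    _ ≤ ∑ g ∈ E.gates.toFinset, φ g :=
        Finset.sum_le_sum_of_subset_of_nonneg (Finset.filter_subset _ _) fun _ _ _ => Nat.zero_le _
    _ ≤ ∑ g ∈ E.gates.toFinset, E.gates.count g • φ g := by
        refine Finset.sum_le_sum fun g hg => ?_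
        rw [smul_eq_mul]
        exact Nat.le_mul_of_pos_left _ (List.count_pos_iff.2 (List.mem_toFinset.1 hg))
    _ = (E.gates.map φ).sum := (Finset.sum_list_map_count _ _).symm

/-! ### Fourier: one guess has a large top coefficient -/

variable {n : ℕ}

/-- Fourier coefficients of a finite sum of functions. [cite: ODonnell2014, §1.2] -/
theorem cubeFourierCoeff_finset_sum {κ : Type*} (s : Finset κ) (g : κ → (Fin n → Bool) → ℝ)
    (S : Finset (Fin n)) :
    cubeFourierCoeff (fun x => ∑ k ∈ s, g k x) S = ∑ k ∈ s, cubeFourierCoeff (g k) S := by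
  simp only [cubeFourierCoeff, Finset.sum_mul, Finset.sum_div]
  rw [Finset.sum_comm]

/-- `sgn b = 1 - 2·[b]`. [folklore] -/
theorem sgn_eq_one_sub (b : Bool) : sgn b = 1 - 2 * (if b then (1 : ℝ) else 0) := by
  cases b <;> norm_num [sgn]

/-- The `{±1}` versions of the subfunctions sum to a constant plus the `{±1}` version of `E`. [folklore] -/
theorem sum_sgn_guessFn (E : Circuit (Fin n)) {d : ℕ} (hd : E.acDepth ≤ d) (x : Fin n → Bool) :
    ∑ β : OPos E d → Bool, sgn (guessFn E d β x) =
      ((Fintype.card (OPos E d → Bool) : ℝ) - 1) + sgn (E.eval x) := by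
  simp only [sgn_eq_one_sub]
  rw [Finset.sum_sub_distrib, Finset.sum_const, Finset.card_univ, ← Finset.mul_sum,
    sum_guessFn_indicator E hd x, nsmul_eq_mul, mul_one]
  ring

/-- **The top Fourier coefficients of the subfunctions sum to that of `E`** (at any nonempty
`S`, the constant having no weight there). [folklore] -/
theorem sum_cubeFourierCoeff_sgn_guessFn (E : Circuit (Fin n)) {d : ℕ} (hd : E.acDepth ≤ d)
    {S : Finset (Fin n)} (hS : S ≠ ∅) :
    ∑ β : OPos E d → Bool, cubeFourierCoeff (fun x => sgn (guessFn E d β x)) S =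
      cubeFourierCoeff (fun x => sgn (E.eval x)) S := by
  rw [← cubeFourierCoeff_finset_sum]
  have : (fun x => ∑ β : OPos E d → Bool, sgn (guessFn E d β x)) =
      fun x => (fun _ => (Fintype.card (OPos E d → Bool) : ℝ) - 1) x + (fun x => sgn (E.eval x)) x :=
    funext (sum_sgn_guessFn E hd)
  rw [this, cubeFourierCoeff_add, cubeFourierCoeff_const hS, zero_add]

/-- **Pigeonhole**: some guess has top coefficient at least the average. [folklore] -/
theorem exists_guess_coeff_ge (E : Circuit (Fin n)) {d : ℕ} (hd : E.acDepth ≤ d)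
    {S : Finset (Fin n)} (hS : S ≠ ∅) :
    ∃ β : OPos E d → Bool, cubeFourierCoeff (fun x => sgn (E.eval x)) S /
        Fintype.card (OPos E d → Bool) ≤ cubeFourierCoeff (fun x => sgn (guessFn E d β x)) S := by
  obtain ⟨β, -, hβ⟩ := Finset.exists_le_of_sum_le (Finset.univ_nonempty (α := OPos E d → Bool))
    (f := fun _ => cubeFourierCoeff (fun x => sgn (E.eval x)) S / Fintype.card (OPos E d → Bool))
    (g := fun β => cubeFourierCoeff (fun x => sgn (guessFn E d β x)) S) (by
      rw [Finset.sum_const, Finset.card_univ, sum_cubeFourierCoeff_sgn_guessFn E hd hS,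
        nsmul_eq_mul, mul_div_cancel₀]
      exact Nat.cast_ne_zero.2 Fintype.card_ne_zero)
  exact ⟨β, hβ⟩

/-- The `{±1}` version of parity is the top character `χ_{[n]}`. [cite: ODonnell2014, §1.2] -/
theorem sgn_parityFn (x : Fin n → Bool) : sgn (parityFn n x) = walsh univ x := by
  have hprod : walsh (univ : Finset (Fin n)) x = (-1 : ℝ) ^ GateFn.numOnes x := by
    rw [walsh, GateFn.numOnes]
    have : ∀ i : Fin n, sgn (x i) = if x i = true then (-1 : ℝ) else 1 := fun i => by
      cases x i <;> simp [sgn]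
    simp only [this]
    rw [Finset.prod_ite, Finset.prod_const, Finset.prod_const_one, mul_one]
  rw [hprod, parityFn]
  rcases Nat.even_or_odd (GateFn.numOnes x) with h | h
  · rw [h.neg_one_pow]
    have : ¬ GateFn.numOnes x % 2 = 1 := by rw [Nat.even_iff.1 h]; omega
    simp [this, sgn]
  · rw [h.neg_one_pow]
    simp [Nat.odd_iff.1 h, sgn]

/-- `χ̂_{[n]}([n]) = 1`. [cite: ODonnell2014, §1.4] -/
theorem cubeFourierCoeff_walsh_univ (n : ℕ) :
    cubeFourierCoeff (walsh (univ : Finset (Fin n))) univ = 1 := by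
  rw [cubeFourierCoeff, sum_walsh_mul_walsh_index, if_pos rfl, div_self (pow_ne_zero _ two_ne_zero)]

/-- The squared top coefficient is part of the top tail weight. [cite: Tal2017, §2.2] -/
theorem sq_cubeFourierCoeff_univ_le_tailWeight (g : (Fin n → Bool) → ℝ) :
    cubeFourierCoeff g univ ^ 2 ≤ tailWeight g n := by
  unfold tailWeight
  exact Finset.single_le_sum (f := fun S => cubeFourierCoeff g S ^ 2) (fun _ _ => sq_nonneg _)
    (by simp)

/-! ### One input length: the quantitative inequality -/

/-- **The inequality at one length.** If a circuit of `acDepth ≤ d` and size `≤ s` whose gates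
outside `acBasis` have total fan-in `≤ W` computes parity of `n ≥ 1` bits, then
`n ≤ B^{d+2} · ℓ^d · (3(d+2) + 2W)` with `ℓ = ⌊log₂(2s₁+1)⌋`, `s₁ = (W+1)(s+1)+1`, `B = 16896`:
the guess with a large top coefficient is an `AC⁰` function of depth `d+1` and size `≤ s₁`, whose
top Fourier weight Tal's theorem bounds by `8^{d+2} 2^{-n/(B^{d+2} ℓ^d)}`. [folklore] -/
theorem main_ineq (hn : 1 ≤ n) (E : Circuit (Fin n)) {d s W : ℕ} (hd : E.acDepth ≤ d)
    (hs : E.size ≤ s) (hW : (E.gates.map fun g => if g.fn ∈ acBasis then 0 else g.arity).sum ≤ W)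
    (hpar : ∀ x, E.eval x = parityFn n x) :
    n ≤ ACForm.cB ^ (d + 2) * Nat.log 2 (2 * ((W + 1) * (s + 1) + 1) + 1) ^ d *
      (3 * (d + 2) + 2 * W) := by
  haveI : Nonempty (Fin n) := ⟨⟨0, hn⟩⟩
  have hS : (univ : Finset (Fin n)) ≠ ∅ := Finset.univ_nonempty.ne_empty
  set s₁ := (W + 1) * (s + 1) + 1 with hs₁
  set P := Fintype.card (OPos E d) with hP
  have hPW : P ≤ W := (card_OPos_le E d).trans hW
  -- the good guess
  obtain ⟨β, hβ⟩ := exists_guess_coeff_ge E hd hS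
  have htop : cubeFourierCoeff (fun x => sgn (E.eval x)) univ = 1 := by
    have : (fun x => sgn (E.eval x)) = walsh (univ : Finset (Fin n)) := by
      funext x; rw [hpar x, sgn_parityFn]
    rw [this, cubeFourierCoeff_walsh_univ]
  have hN : (Fintype.card (OPos E d → Bool) : ℝ) = 2 ^ P := by
    rw [Fintype.card_fun, Fintype.card_bool, hP]; push_cast; rfl
  rw [htop, hN] at hβ
  -- the good guess is a small AC⁰ circuit
  have hreal : ACReal (guessFn E d β) (d + 1) s₁ := by
    refine (acReal_guessFn E hd β).mono le_rfl ?_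
    rw [hs₁]
    have h1 : Fintype.card (OPos E d) + 1 ≤ W + 1 := Nat.succ_le_succ hPW
    have h2 : E.gates.length + 1 ≤ s + 1 := Nat.succ_le_succ hs
    exact Nat.succ_le_succ (Nat.mul_le_mul h1 h2)
  obtain ⟨C, hCB, hCd, hCs, hCev⟩ := hreal.toCircuit
  obtain ⟨f, hfev, hfh, hfw, hfs⟩ := C.exists_acForm hCB
  have hM : 1 ≤ 2 * s₁ := by rw [hs₁]; omega
  have htal := ACForm.tailWeight_le_tailBound hM (d + 2) (by omega) f 1 le_rfl
    (ACForm.one_le_logM hM) (hfh.trans (by omega)) (hfs.trans (by omega)) hfw n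
  have hsgn : f.sgnEval = fun x => sgn (guessFn E d β x) := by
    funext x; rw [ACForm.sgnEval, hfev, hCev]
  rw [hsgn] at htal
  -- combine
  have hlow : ((1 : ℝ) / 2 ^ P) ^ 2 ≤ tailWeight (fun x => sgn (guessFn E d β x)) n :=
    (pow_le_pow_left₀ (by positivity) hβ 2).trans (sq_cubeFourierCoeff_univ_le_tailWeight _)
  have key := hlow.trans htal
  -- unfold Tal's bound and take logarithms
  simp only [ACForm.tailBound, ACForm.logM, Nat.cast_one, mul_one, Nat.add_sub_cancel] at key
  set ℓ := Nat.log 2 (2 * s₁ + 1) with hℓ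
  set A : ℝ := (ACForm.cB : ℝ) ^ (d + 2) * (ℓ : ℝ) ^ d with hA
  have hcB : (1 : ℝ) ≤ ACForm.cB := by unfold ACForm.cB ACForm.B0; norm_num
  have hℓ1 : (1 : ℝ) ≤ ℓ := by
    have := ACForm.one_le_logM hM
    rw [ACForm.logM] at this
    exact_mod_cast this
  have hApos : 0 < A := by rw [hA]; positivity
  have hl2 : 0 < Real.log 2 := Real.log_pos one_lt_two
  have hcA : Real.log (ACForm.cA : ℝ) = 3 * Real.log 2 := by
    rw [show ((ACForm.cA : ℕ) : ℝ) = 2 ^ 3 by unfold ACForm.cA; norm_num, Real.log_pow]; norm_num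
  have hlog := Real.log_le_log (by positivity) key
  rw [Real.log_pow, Real.log_div one_ne_zero (by positivity), Real.log_one, zero_sub, Real.log_pow,
    Real.log_mul (by unfold ACForm.cA; positivity) (Real.exp_ne_zero _), Real.log_pow,
    Real.log_exp, hcA] at hlog
  -- hlog : 2 * -(P * log 2) ≤ (d+2) * (3 log 2) + -(n log 2 / A)
  have h1 : (n : ℝ) * Real.log 2 / A ≤ (3 * (d + 2) + 2 * P) * Real.log 2 := by
    push_cast at hlog ⊢; linarith
  have h2 : (n : ℝ) ≤ A * (3 * (d + 2) + 2 * P) := by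
    rw [div_le_iff₀ hApos] at h1
    nlinarith
  have h3 : (n : ℝ) ≤ A * (3 * (d + 2) + 2 * W) := by
    refine h2.trans (mul_le_mul_of_nonneg_left ?_ hApos.le)
    have : (P : ℝ) ≤ W := by exact_mod_cast hPW
    linarith
  rw [hA] at h3
  exact_mod_cast h3

/-! ### Elementary growth lemmas -/

/-- Polylogarithms are eventually below `n`: `c (log₂ n)^k ≤ n` for large `n`. [folklore] -/
theorem eventually_mul_log_pow_le (c k : ℕ) : ∀ᶠ n : ℕ in atTop, c * Nat.log 2 n ^ k ≤ n := by
  have ht := tendsto_pow_const_div_const_pow_of_one_lt (k + 1) (one_lt_two (α := ℝ))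
  have hev : ∀ᶠ m : ℕ in atTop, (m : ℝ) ^ (k + 1) / 2 ^ m ≤ 1 := ht.eventually (ge_mem_nhds one_pos)
  obtain ⟨N₀, hN₀⟩ := eventually_atTop.1 hev
  refine eventually_atTop.2 ⟨2 ^ max N₀ c, fun n hn => ?_⟩
  have hn0 : n ≠ 0 := (lt_of_lt_of_le (Nat.two_pow_pos _) hn).ne'
  set L := Nat.log 2 n with hL
  have hLge : max N₀ c ≤ L := Nat.le_log_of_pow_le one_lt_two hn
  have h1 : (L : ℝ) ^ (k + 1) / 2 ^ L ≤ 1 := hN₀ L (le_of_max_le_left hLge)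
  rw [div_le_one (by positivity)] at h1
  have h2 : L ^ (k + 1) ≤ 2 ^ L := by exact_mod_cast h1
  calc c * L ^ k ≤ L * L ^ k := Nat.mul_le_mul_right _ (le_of_max_le_right hLge)
    _ = L ^ (k + 1) := by ring
    _ ≤ 2 ^ L := h2
    _ ≤ n := Nat.pow_log_le_self 2 hn0

/-- A polynomial over `ℕ` is below a fixed power for `n ≥ 2`. [folklore] -/
theorem natPoly_exists_le_pow (q : Polynomial ℕ) : ∃ K : ℕ, ∀ n, 2 ≤ n → q.eval n ≤ n ^ K := by
  refine ⟨q.eval 1 + q.natDegree, fun n hn => ?_⟩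
  calc q.eval n ≤ q.eval 1 * n ^ q.natDegree :=
        Literature.Computability.Complexity.natPoly_eval_le_eval_one_mul_pow q (show 1 ≤ n by omega)
    _ ≤ 2 ^ q.eval 1 * n ^ q.natDegree := Nat.mul_le_mul_right _ Nat.lt_two_pow_self.le
    _ ≤ n ^ q.eval 1 * n ^ q.natDegree := Nat.mul_le_mul_right _ (Nat.pow_le_pow_left hn _)
    _ = n ^ (q.eval 1 + q.natDegree) := by rw [pow_add]

/-- `⌊log₂ (n^K)⌋ ≤ K (⌊log₂ n⌋ + 1)`. [folklore] -/
theorem log_two_pow_le (n K : ℕ) : Nat.log 2 (n ^ K) ≤ K * (Nat.log 2 n + 1) := by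
  have h : n ^ K ≤ 2 ^ (K * (Nat.log 2 n + 1)) := by
    rw [mul_comm, pow_mul]
    exact Nat.pow_le_pow_left (Nat.lt_pow_succ_log_self one_lt_two n).le K
  calc Nat.log 2 (n ^ K) ≤ Nat.log 2 (2 ^ (K * (Nat.log 2 n + 1))) := Nat.log_mono_right h
    _ = K * (Nat.log 2 n + 1) := Nat.log_pow one_lt_two _

/-- The arithmetic endgame: the inequality of `main_ineq` is incompatible, for `L = ⌊log₂ n⌋`
large, with `ℓ ≤ kL`, `W L^{d+1} ≤ n` and `3 A L^d ≤ n`. [folklore] -/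
theorem endgame {n d c₁ k ℓ L W : ℕ} (hn : 1 ≤ n)
    (h1 : n ≤ c₁ * ℓ ^ d * (3 * (d + 2) + 2 * W)) (h2 : ℓ ≤ k * L)
    (h3 : W * L ^ (d + 1) ≤ n) (h4 : 3 * (c₁ * k ^ d * (3 * (d + 2))) * L ^ d ≤ n)
    (h5 : 3 * (2 * c₁ * k ^ d) ≤ L) : False := by
  have hℓ : ℓ ^ d ≤ k ^ d * L ^ d := by rw [← mul_pow]; exact Nat.pow_le_pow_left h2 d
  -- n ≤ A L^d + B L^d W
  have h1' : n ≤ c₁ * k ^ d * (3 * (d + 2)) * L ^ d + 2 * c₁ * k ^ d * (L ^ d * W) := by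
    calc n ≤ c₁ * ℓ ^ d * (3 * (d + 2) + 2 * W) := h1
      _ ≤ c₁ * (k ^ d * L ^ d) * (3 * (d + 2) + 2 * W) :=
          Nat.mul_le_mul_right _ (Nat.mul_le_mul_left _ hℓ)
      _ = c₁ * k ^ d * (3 * (d + 2)) * L ^ d + 2 * c₁ * k ^ d * (L ^ d * W) := by ring
  -- 3 B (L^d W) ≤ L^{d+1} W ≤ n
  have h3' : 3 * (2 * c₁ * k ^ d * (L ^ d * W)) ≤ n := by
    calc 3 * (2 * c₁ * k ^ d * (L ^ d * W)) = 3 * (2 * c₁ * k ^ d) * (L ^ d * W) := by ring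
      _ ≤ L * (L ^ d * W) := Nat.mul_le_mul_right _ h5
      _ = W * L ^ (d + 1) := by ring
      _ ≤ n := h3
  have h4' : 3 * (c₁ * k ^ d * (3 * (d + 2)) * L ^ d) ≤ n := by
    calc 3 * (c₁ * k ^ d * (3 * (d + 2)) * L ^ d) = 3 * (c₁ * k ^ d * (3 * (d + 2))) * L ^ d := by ring
      _ ≤ n := h4
  clear h1 h2 h3 h4 h5 hℓ
  generalize c₁ * k ^ d * (3 * (d + 2)) * L ^ d = X at h1' h4'
  generalize 2 * c₁ * k ^ d * (L ^ d * W) = Y at h1' h3'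
  omega

/-- A family deciding `PARITY` computes `parityFn n` at every length `n`. [folklore] -/
theorem eval_eq_parityFn {E : CircuitFamily} (h : E.Decides PARITY) {n : ℕ} (x : Fin n → Bool) :
    (E n).eval x = parityFn n x := by
  rw [h.eval_eq x]
  have key : ∀ (z : List Bool) (N : ℕ) (hz : z.length = N),
      PARITY.boolIndicator z = parityFn N (fun i => z.get (i.cast hz.symm)) := by
    rintro z _ rfl
    change PARITY.boolIndicator z = parityFn z.length z.get
    by_cases hz : z ∈ PARITY
    · rw [(Set.mem_iff_boolIndicator _ _).1 hz]
      exact (show parityFn z.length z.get = true from hz).symm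
    · rw [(Set.notMem_iff_boolIndicator _ _).1 hz]
      have hz' : parityFn z.length z.get ≠ true := hz
      exact (Bool.eq_false_iff.2 hz').symm
  rw [key (List.ofFn x) n (List.length_ofFn ..)]
  congr 1
  funext i
  simp

end ParityLocalizes

/-! ### The theorem -/

open ParityLocalizes in
/-- **CHOPRS Prop. 50 (E3^𝒪), proved**: for every oracle `𝒪`, depth `d`, polynomial size bound
`p` and wire budget `w(n) = n/(log n)^{ω(1)}`, no family of depth-`d`, size-`p(n)` circuits over
`∧, ∨, ¬` and `𝒪`-gates of total fan-in `≤ w(n)` decides `PARITY`. The printed proof points to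
interactive compression games and the Chattopadhyay–Santhanam random-restriction method for
oracle circuits; this proof instead guesses the `≤ w(n)` oracle-input wires — writing the
circuit as a sum of `2^{w(n)}` `AC⁰_{d+1}[poly]` subfunctions, one of which has top Fourier
coefficient `≥ 2^{-w(n)}` — and applies Tal's Fourier-tail bound for `AC⁰` (tree theorem
`ACForm.tailWeight_le_tailBound`, Tal 2017 Thm. 3.6, itself proved from Håstad's multi-switching
lemma), which forces `n ≤ O_d((log n)^d (w(n) + 1))`, contradicting `w(n)(log n)^{d+1} ≤ n`.
[cite: arXiv191108297, Prop. 50 (E3^𝒪) with proof, p. 27] -/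
theorem Locality_parityLocalizes_holds : Locality_parityLocalizes := by
  intro 𝒪 d p w hw ⟨E, hE, hdec⟩
  -- constants
  obtain ⟨K, hK⟩ := natPoly_exists_le_pow (p + Polynomial.X + 2)
  set c₁ : ℕ := ACForm.cB ^ (d + 2) with hc₁
  set k : ℕ := 6 * K with hk
  -- a large length `n`
  have e1 := eventually_ge_atTop 2
  have e2 : ∀ᶠ n : ℕ in atTop, w n ≤ n := (hw 0).mono fun n h => by simpa using h
  have e3 := hw (d + 1)
  have e4 := eventually_mul_log_pow_le (3 * (c₁ * k ^ d * (3 * (d + 2)))) d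
  have e5 : ∀ᶠ n : ℕ in atTop, 3 * (2 * c₁ * k ^ d) ≤ Nat.log 2 n :=
    (eventually_ge_atTop (2 ^ (3 * (2 * c₁ * k ^ d)))).mono fun n hn =>
      Nat.le_log_of_pow_le one_lt_two hn
  obtain ⟨n, hn2, hwn, hwL, hpl, hL⟩ := (e1.and (e2.and (e3.and (e4.and e5)))).exists
  obtain ⟨-, hdep, hsize, hwire⟩ := hE n
  -- the inequality at length `n`
  have main := main_ineq (show 1 ≤ n by omega) (E n) hdep hsize hwire (eval_eq_parityFn hdec)
  -- bounding `ℓ`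
  have hT : p.eval n + n + 2 ≤ n ^ K := by
    have := hK n hn2
    simpa [Polynomial.eval_add] using this
  have hs₁ : 2 * ((w n + 1) * (p.eval n + 1) + 1) + 1 ≤ n ^ (3 * K) := by
    set T := p.eval n + n + 2 with hTdef
    have hT3 : 3 ≤ T := by omega
    have hw1 : w n + 1 ≤ T := by omega
    have hp1 : p.eval n + 1 ≤ T := by omega
    have hTT : 9 ≤ T * T := Nat.mul_le_mul hT3 hT3
    have hTTT : 3 * (T * T) ≤ T * T * T := by
      rw [mul_comm (T * T) T]; exact Nat.mul_le_mul_right _ hT3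
    calc 2 * ((w n + 1) * (p.eval n + 1) + 1) + 1 ≤ 2 * (T * T + 1) + 1 := by
          have := Nat.mul_le_mul hw1 hp1; omega
      _ ≤ T * T * T := by omega
      _ = T ^ 3 := by ring
      _ ≤ (n ^ K) ^ 3 := Nat.pow_le_pow_left hT 3
      _ = n ^ (3 * K) := by rw [← pow_mul, mul_comm]
  have hℓ : Nat.log 2 (2 * ((w n + 1) * (p.eval n + 1) + 1) + 1) ≤ k * Nat.log 2 n := by
    have hL1 : 1 ≤ Nat.log 2 n := Nat.le_log_of_pow_le one_lt_two (by simpa using hn2)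
    calc Nat.log 2 (2 * ((w n + 1) * (p.eval n + 1) + 1) + 1) ≤ Nat.log 2 (n ^ (3 * K)) :=
          Nat.log_mono_right hs₁
      _ ≤ 3 * K * (Nat.log 2 n + 1) := log_two_pow_le n (3 * K)
      _ ≤ 3 * K * (2 * Nat.log 2 n) := Nat.mul_le_mul_left _ (by omega)
      _ = k * Nat.log 2 n := by rw [hk]; ring
  exact endgame (show 1 ≤ n by omega) main hℓ hwL hpl hL

/-! ### Corollary: `PARITY ∉ AC⁰` -/

/-- **Corollary (the unrelativized E3, `Parity ∉ AC⁰`, Furst–Saxe–Sipser / Ajtai / Håstad).**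
With the empty wire budget `w = 0` (no oracle gates), `Locality_parityLocalizes` says that no
constant-depth polynomial-size circuit family over `∧, ∨, ¬` decides `PARITY`.
[cite: arXiv191108297, §1.1 (HM Frontier E, item E3) and Prop. 50] -/
theorem Locality_parityLocalizes.parity_not_mem_AC0 (h : Locality_parityLocalizes) :
    PARITY ∉ AC0 := by
  rintro ⟨d, p, C, hC, hdec⟩
  refine h (0 : Language Bool) d p (fun _ => 0) (fun j => Eventually.of_forall fun n => by simp)
    ⟨C, fun n => ⟨(hC n).1.mono Set.subset_union_left, (hC n).2.1, (hC n).2.2, le_of_eq ?_⟩, hdec⟩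
  refine List.sum_eq_zero fun a ha => ?_
  obtain ⟨g, hg, rfl⟩ := List.mem_map.1 ha
  rw [if_pos ((hC n).1 g hg)]

/-- **`PARITY ∉ AC⁰`**, proved (Furst–Saxe–Sipser 1984, Ajtai 1983; Håstad 1986, Thm. 1 for the
exponential bound, which is the tree's named fact `Literature.Computability.Complexity.hastad_parity`): the class statement
`PARITY ∉ AC0` for the tree's `AC0` (constant `acDepth`, polynomial size, basis `acBasis`).
[cite: Hastad1986, Thm. 1] -/
theorem PARITY_not_mem_AC0 : PARITY ∉ AC0 :=
  Locality_parityLocalizes_holds.parity_not_mem_AC0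

end Literature.Barriers.PneNP

end
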